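import Literature.MathematicalPhysics.QuantumFieldTheory.Balaban1983to89.Beta.ComposedRoad
import Literature.MathematicalPhysics.QuantumFieldTheory.Balaban1983to89.Beta.MinimiserIdentityForm

/-!
# Bałaban's lattice YM₄ RG programme — β-function sub-cell: THE SCALE-WISE FORM OF THE WALL'S ONE-LOOP BINDER `hident`
# (row BETA-an2; RULING (R16-2)/(R16-3) of the β sub-cell, typed)

HONEST FRAMING (cell rule, verbatim): «discharging BetaPertH makes Balaban's UV stability UNCONDITIONAL — a real
constructive-QFT result; it is NOT the continuum limit and NOT the Clay problem.»  This module formalises NO statement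
printed in Bałaban's papers and cites none as a fact; it is [folklore] bookkeeping over sibling leaves already in the tree
(`Beta/ComposedRoad` §10, `Beta/MinimiserIdentityForm`, `Beta/DressedMomentNormalisation`, `Beta/MarginalTelescoping`).
It DISCHARGES NOTHING of the wall: it re-expresses the wall's one binder about the one-loop physics as two typed statements
and proves the implication.  NOT summit progress.

## What the wall assumes of the one-loop physics (RULING (R16-2))

At END-STATEMENT grade the β sub-cell's wall `ComposedRoad.endpointExistence_of_composedLegInterfacePow_identity_avg_remainderConst`
is applied at the TRIVIAL instance `μC := fun j _ => β⁰ j`, `hid := rfl` (RULING (R16-1)); its ENTIRE one-loop content is then the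
identification binder

  (D1)  `∀ m ≥ 1, ∃ R₀ ≥ M (Lc^m), |Σ_{j<m} β⁰_j − Σ_{b ∈ Bset (Lc^m)} wt_b · Σ_{w ∈ annulus 4 0 R₀} w_μ w_ν Σ_i cc₀ i · F′_b i (Lc^m) w · G′_b i (Lc^m) w| ≤ U`

— the partial sums of the one-loop coefficients are REPRESENTED, up to an `m`-uniform error, by the base-point-averaged window sum of
the leg bilinear of the cell's table at the one-shot blocking factor `n = Lc^m`.

## The scale-wise form (RULING (R16-3): «read β⁰_j = F(M2(T_j)) out of the scale-j Hessian, then prove `hident` scale by scale»)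

A naive scale-by-scale comparison (β⁰_m ≈ bilinear at `Lc^{m+1}` minus bilinear at `Lc^m`) would ACCUMULATE errors in `m`.  The form
below does not: the `m`-dependence is carried by two EXACT identities and ONE comparison per scale.  Data: one-step Hessian kernels
`T j : EKer 4` (matrix kernels on `ℤ⁴`), one-shot Hessian kernels `𝒯 m : EKer 4` (in the coarse units of scale `m`), a read-out `F`
ADDITIVE on tensors.  Hypotheses:

* `hβ    : ∀ j, β⁰ j = F (m2Tensor (T j))` — the READ-OUT of the flow coefficient from the scale-`j` Hessian kernel (the wall's own
  binder shape; for Bałaban's objects it is the reading of [B12] (1.20)–(1.22): a hypothesis, never a fact);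
* (N1-B) `HessianTelescoping`: `∀ m ≥ 1, Σ_{j<m} coarseTensor (Lc^(m−j)) (wK (Lc^(m−j))) (T j) = m2Tensor (𝒯 m)` — the second-moment
  tensors of the one-step Hessians PULLED BACK through the typed U = 1 KKT solution-operator kernels `wK` (an2 `KernelSpecInstance`,
  dressing `Wᵀ T W` of `DressedMomentNormalisation`) ADD UP to the second-moment tensor of the one-shot Hessian kernel at blocking
  `Lc^m` (the kernel-level statement `KernelTelescoping` implies it, §4);
* (I2-rep) `∀ m ≥ 1, ∃ R₀ ≥ M (Lc^m), |F (m2Tensor (𝒯 m)) − (averaged window sum of the leg bilinear at Lc^m)| ≤ U` — ONE full-sum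
  comparison per scale between the read-out of the one-shot Hessian and the legs (master formula / window identification /
  contact terms live here: `LogDetHessian`, `WindowIdentification`, `CrossTermBounds`, `SquareTable.hident_of_stencilFullSum`).

THEN (D1) holds (`hident_trivial_of_scalewise`): `Σ_{j<m} β⁰_j = Σ_{j<m} F (m2Tensor (T j)) = Σ_{j<m} F (coarseTensor …)` (an2's
`MinimiserIdentityForm.coarseTensor_minimiser`: the typed solution operator reproduces the marginal read-out EXACTLY, from Hessian data
`AbsMoment₂` + (T0)/(T1) alone) `= F (Σ_{j<m} coarseTensor …)` (additivity) `= F (m2Tensor (𝒯 m))` (N1-B), and (I2-rep) is the claim.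
For the lead's non-trivial instance `μC j k := F (coarseTensor (Lc^(k−j)) (wK (Lc^(k−j))) (T j))` (`ComposedRoadFromSpec` §2) the same
`hident` follows from (N1-B) + (I2-rep) + additivity ALONE (`hident_minimiser_of_scalewise`).  §3 plugs both into the wall:
`oneLoopDrift_of_scalewise`, `endpointExistence_of_scalewise_remainderConst` (+ `_of_symmetries`).

## No free lunch (beta-ref A-R290 / C-beta-167 honoured)

`(T, F, hβ)` are inhabited for EVERY `β⁰` (dipole kernel, `F M := M 0 0 0 0 / 2`); at such a witness (N1-B) FORCES
`F (m2Tensor (𝒯 m)) = Σ_{j<m} β⁰_j` and (I2-rep) IS (D1) again (`oneShotRep_iff_hident_of_telescoping`).  The split therefore moves no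
content unless `T j`, `𝒯 m` are the GENUINE one-step / one-shot one-loop Hessian kernels; what it buys is the SHAPE of a scale-wise
proof whose error does not accumulate: (N1-B) is an exact identity (Gaussian telescoping of the fluctuation integrals composed through
affine-reproducing minimisers — cell items (N1)/(AFF-lin); tree pieces `Dimock2015.NormalizationTelescoping`, `OneShotTelescope`,
`AffineAveraging`, `KernelRepresentation`), and (I2-rep) is ONE comparison per scale with the window radius `R₀` free per scale.

## READING CLAUSE (as in `ComposedRoadFromSpec`, (W-KKT-2))

`wK` is the response kernel of the solution operator of the TYPED U = 1 block-averaging KKT system (`KernelSpecInstance.specK`).  Its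
identification with Bałaban's U = 1 gauge-fixed linearised minimiser ([Balaban1984PropagatorsI, p. 26, (1.48)–(1.49)];
[Balaban1985BackgroundPropagators, p. 417, (3.109)–(3.110) at U = 1]) and of `T j` / `𝒯 m` with the one-step / one-shot one-loop
Hessian kernels of [Balaban1987RG1, p. 264, (1.20)–(1.22)] is the sub-cell's READING (Y15)(b)/(Y19) (row file BETA/AN2.md §12, label
DICT-KKT) — a dictionary, NOT proved here or anywhere in the tree, never a hypothesis, never cited.
-/

noncomputable section

namespace Literature.MathematicalPhysics.QuantumFieldTheory.Balaban1983to89.Beta.HidentScalewise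

open Finset
open Literature.Probability.LatticeModels (annulus)
open Literature.MathematicalPhysics.QuantumFieldTheory.Balaban1983to89
open FlowStep FlowStepRuns DagBinding
open Literature.MathematicalPhysics.QuantumFieldTheory.Balaban1983to89.Beta.TransverseStructure (E4)
open Literature.MathematicalPhysics.QuantumFieldTheory.Balaban1983to89.Beta.LeadingCoefficient (leadingIntegrand kappaBal transverseValue)
open Literature.MathematicalPhysics.QuantumFieldTheory.Balaban1983to89.Beta.DyadicShell (Pt toReal supNorm)
open Literature.MathematicalPhysics.QuantumFieldTheory.Balaban1983to89.Beta.BubbleTransfer (Leg contBubble bubbleConst)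
open Literature.MathematicalPhysics.QuantumFieldTheory.Balaban1983to89.Beta.Drift (OneLoopDrift)
open Literature.MathematicalPhysics.QuantumFieldTheory.Balaban1983to89.Beta.RemainderChain (RemainderConst)
open Literature.MathematicalPhysics.QuantumFieldTheory.Balaban1983to89.Beta.MarginalTelescoping (composedCoeff IdentityForm)
open Literature.MathematicalPhysics.QuantumFieldTheory.Balaban1983to89.Beta.LargeLWindow.WindowDecomposition (constA)
open DecimatedMomentSummable (AbsMoment₂)
open DressedMomentNormalisation (EKer dressedEntry coarseTensor m2Tensor)
open MinimiserIdentityForm (wK coarseTensor_minimiser coarseTensor_minimiser_of_symmetries bondSecondMoment_minimiser)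
open ComposedRoad

variable {ι : Type*} {s : Finset ι} {cc₀ : ι → ℝ} {P Q : ι → Leg} {κB : Type*}

/-! ## §1 The two typed statements of the scale-wise form -/

/-- Abbreviation: the four-index second-moment TENSORS. [folklore] -/
abbrev Tensor4 : Type := Fin 4 → Fin 4 → Fin 4 → Fin 4 → ℝ

/-- (N1-B) AT TENSOR LEVEL — **HESSIAN TELESCOPING**: at every one-shot blocking factor `Lc^m`, `m ≥ 1`, the second-moment tensors of
the one-step Hessian kernels `T j`, `j < m`, pulled back through the typed KKT solution-operator kernels `wK (Lc^(m−j))`, ADD UP to the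
second-moment tensor of the one-shot Hessian kernel `𝒯 m` (coarse units of scale `m`).  A predicate, never a fact. [folklore] -/
def HessianTelescoping (Lc : ℕ) [NeZero Lc] (T 𝒯 : ℕ → EKer 4) : Prop :=
  ∀ m : ℕ, 1 ≤ m → ∑ j ∈ range m, coarseTensor (Lc ^ (m - j)) (wK (Lc ^ (m - j))) (T j) = m2Tensor (𝒯 m)

/-- (N1-B) AT KERNEL LEVEL — **KERNEL TELESCOPING**: the decimated dressed kernels `N_j⁸ · (W_jᵀ T_j W_j)(N_j z)`, `N_j = Lc^(m−j)`,
ADD UP entrywise to the one-shot Hessian kernel `𝒯 m` on the coarse lattice of scale `m`.  A predicate, never a fact. [folklore] -/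
def KernelTelescoping (Lc : ℕ) [NeZero Lc] (T 𝒯 : ℕ → EKer 4) : Prop :=
  ∀ m : ℕ, 1 ≤ m → ∀ (a b : Fin 4) (z : Fin 4 → ℤ),
    ∑ j ∈ range m, ((Lc ^ (m - j) : ℕ) : ℝ) ^ 8 * dressedEntry (wK (Lc ^ (m - j))) (T j) (((Lc ^ (m - j) : ℕ) : ℤ) • z) a b
      = 𝒯 m a b z

/-- (I2-rep) — **ONE-SHOT REPRESENTATION**: ONE comparison per scale between the read-out `F` of the one-shot Hessian kernel `𝒯 m`
and the base-point-averaged window sum of the leg bilinear of the cell's table at blocking `Lc^m` (window radius `R₀ ≥ M (Lc^m)` free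
per scale, error `U` uniform in `m`).  A predicate, never a fact. [folklore] -/
def OneShotRepresentation (Lc : ℕ) (F : Tensor4 → ℝ) (𝒯 : ℕ → EKer 4) (s : Finset ι) (cc₀ : ι → ℝ) (μ ν : Fin 4)
    (Bset : ℕ → Finset κB) (wt : ℕ → κB → ℝ) (F' G' : κB → ι → ℕ → Pt → ℝ) (M : ℕ → ℕ) (U : ℝ) : Prop :=
  ∀ m : ℕ, 1 ≤ m → ∃ R₀ : ℕ, M (Lc ^ m) ≤ R₀ ∧
    |F (m2Tensor (𝒯 m)) - ∑ b ∈ Bset (Lc ^ m), wt (Lc ^ m) b * ∑ w ∈ annulus 4 0 R₀, toReal w μ * toReal w ν *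
        ∑ i ∈ s, cc₀ i * (F' b i (Lc ^ m) w * G' b i (Lc ^ m) w)| ≤ U

/-! ## §2 The algebra: additive read-outs, the composed coefficient at the two instances -/

/-- An additive read-out vanishes at `0`. [folklore] -/
theorem readout_zero {F : Tensor4 → ℝ} (hFadd : ∀ A B, F (A + B) = F A + F B) : F 0 = 0 := by
  have h := hFadd 0 0
  rw [zero_add] at h
  linarith

/-- An additive read-out passes through finite sums. [folklore] -/
theorem readout_sum {F : Tensor4 → ℝ} (hFadd : ∀ A B, F (A + B) = F A + F B) {α : Type*} (t : Finset α) (A : α → Tensor4) :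
    F (∑ j ∈ t, A j) = ∑ j ∈ t, F (A j) := by
  classical
  induction t using Finset.induction_on with
  | empty => simp [readout_zero hFadd]
  | insert a t ha ih => rw [sum_insert ha, sum_insert ha, hFadd, ih]

/-- The composed coefficient at the TRIVIAL instance `μC := fun j _ => β0 j` is the flow partial sum (RULING (R16-1)). [folklore] -/
theorem composedCoeff_trivial (β0 : ℕ → ℝ) (m : ℕ) : composedCoeff (fun j _ => β0 j) m = ∑ j ∈ range m, β0 j := rfl

/-- `IdentityForm` at the trivial instance holds by `rfl` (RULING (R16-1): `hid` was never load-bearing). [folklore] -/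
theorem identityForm_trivial (β0 : ℕ → ℝ) : IdentityForm (fun j _ => β0 j) β0 := fun _ _ _ => rfl

/-- **THE READ-OUTS TELESCOPE**: under (N1-B) and additivity of `F`, the sum of the pulled-back read-outs IS the one-shot read-out.
No Hessian data needed. [folklore] -/
theorem sum_readout_coarse_eq {Lc : ℕ} [NeZero Lc] {T 𝒯 : ℕ → EKer 4} (htel : HessianTelescoping Lc T 𝒯)
    {F : Tensor4 → ℝ} (hFadd : ∀ A B, F (A + B) = F A + F B) {m : ℕ} (hm : 1 ≤ m) :
    ∑ j ∈ range m, F (coarseTensor (Lc ^ (m - j)) (wK (Lc ^ (m - j))) (T j)) = F (m2Tensor (𝒯 m)) := by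
  rw [← htel m hm, readout_sum hFadd]

/-- **THE FLOW PARTIAL SUM IS THE ONE-SHOT READ-OUT**: under `hβ`, Hessian data (`AbsMoment₂`, (T0), (T1)), (N1-B) and additivity,
`Σ_{j<m} β⁰_j = F (m2Tensor (𝒯 m))` — the typed solution operator reproduces the read-out exactly
(`MinimiserIdentityForm.coarseTensor_minimiser`), then the tensors telescope. [folklore] -/
theorem flowSum_eq_oneShotReadout {Lc : ℕ} [NeZero Lc] {T 𝒯 : ℕ → EKer 4}
    (hTA : ∀ j c e, AbsMoment₂ (T j c e)) (hT0 : ∀ j c e, HasSum (T j c e) 0)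
    (hT1 : ∀ j c e (ρ : Fin 4), HasSum (fun t : Fin 4 → ℤ => t ρ • T j c e t) 0)
    (htel : HessianTelescoping Lc T 𝒯) {F : Tensor4 → ℝ} (hFadd : ∀ A B, F (A + B) = F A + F B)
    {β0 : ℕ → ℝ} (hβ : ∀ j, β0 j = F (m2Tensor (T j))) {m : ℕ} (hm : 1 ≤ m) :
    ∑ j ∈ range m, β0 j = F (m2Tensor (𝒯 m)) := by
  rw [← sum_readout_coarse_eq htel hFadd hm]
  refine sum_congr rfl fun j _ => ?_
  rw [hβ j, coarseTensor_minimiser (N := Lc ^ (m - j)) (T j) (hTA j) (hT0 j) (hT1 j)]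

/-- … the same with (T0)/(T1) from the two lattice symmetries of the Hessian kernels (divergence-freeness, midpoint inversion).
[folklore] -/
theorem flowSum_eq_oneShotReadout_of_symmetries {Lc : ℕ} [NeZero Lc] {T 𝒯 : ℕ → EKer 4}
    (hTA : ∀ j c e, AbsMoment₂ (T j c e))
    (hdiv : ∀ j (ν : Fin 4) (x : Fin 4 → ℤ), ∑ μ, (T j μ ν x - T j μ ν (x - Pi.single μ 1)) = 0)
    (hinv : ∀ j (μ ν : Fin 4) (y : Fin 4 → ℤ), T j μ ν ((Pi.single ν 1 - Pi.single μ 1) - y) = T j μ ν y)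
    (htel : HessianTelescoping Lc T 𝒯) {F : Tensor4 → ℝ} (hFadd : ∀ A B, F (A + B) = F A + F B)
    {β0 : ℕ → ℝ} (hβ : ∀ j, β0 j = F (m2Tensor (T j))) {m : ℕ} (hm : 1 ≤ m) :
    ∑ j ∈ range m, β0 j = F (m2Tensor (𝒯 m)) := by
  rw [← sum_readout_coarse_eq htel hFadd hm]
  refine sum_congr rfl fun j _ => ?_
  rw [hβ j, coarseTensor_minimiser_of_symmetries (N := Lc ^ (m - j)) (T j) (hTA j) (hdiv j) (hinv j)]

/-! ## §3 The wall's `hident` binder from the scale-wise form, at both instances; the wall plugged -/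

/-- **`hident` AT THE LEAD'S INSTANCE** `μC j k := F (coarseTensor (Lc^(k−j)) (wK (Lc^(k−j))) (T j))` (`ComposedRoadFromSpec` §2)
from (N1-B) + (I2-rep) + additivity of `F` — nothing else. [folklore] -/
theorem hident_minimiser_of_scalewise {Lc : ℕ} [NeZero Lc] {T 𝒯 : ℕ → EKer 4} (htel : HessianTelescoping Lc T 𝒯)
    {F : Tensor4 → ℝ} (hFadd : ∀ A B, F (A + B) = F A + F B) {μ ν : Fin 4}
    {Bset : ℕ → Finset κB} {wt : ℕ → κB → ℝ} {F' G' : κB → ι → ℕ → Pt → ℝ} {M : ℕ → ℕ} {U : ℝ}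
    (hrep : OneShotRepresentation Lc F 𝒯 s cc₀ μ ν Bset wt F' G' M U) :
    ∀ m : ℕ, 1 ≤ m → ∃ R₀ : ℕ, M (Lc ^ m) ≤ R₀ ∧
      |composedCoeff (fun j k => F (coarseTensor (Lc ^ (k - j)) (wK (Lc ^ (k - j))) (T j))) m
        - ∑ b ∈ Bset (Lc ^ m), wt (Lc ^ m) b * ∑ w ∈ annulus 4 0 R₀, toReal w μ * toReal w ν *
          ∑ i ∈ s, cc₀ i * (F' b i (Lc ^ m) w * G' b i (Lc ^ m) w)| ≤ U := by
  intro m hm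
  obtain ⟨R₀, hR₀, h⟩ := hrep m hm
  refine ⟨R₀, hR₀, ?_⟩
  have e : composedCoeff (fun j k => F (coarseTensor (Lc ^ (k - j)) (wK (Lc ^ (k - j))) (T j))) m = F (m2Tensor (𝒯 m)) :=
    sum_readout_coarse_eq htel hFadd hm
  rw [e]
  exact h

/-- **`hident` AT THE TRIVIAL INSTANCE** `μC := fun j _ => β0 j` (RULING (R16-1)/(R16-2): this IS (D1), the wall's entire one-loop
content) from `hβ`, the Hessian data, (N1-B), (I2-rep) and additivity of `F`. [folklore] -/
theorem hident_trivial_of_scalewise {Lc : ℕ} [NeZero Lc] {T 𝒯 : ℕ → EKer 4}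
    (hTA : ∀ j c e, AbsMoment₂ (T j c e)) (hT0 : ∀ j c e, HasSum (T j c e) 0)
    (hT1 : ∀ j c e (ρ : Fin 4), HasSum (fun t : Fin 4 → ℤ => t ρ • T j c e t) 0)
    (htel : HessianTelescoping Lc T 𝒯) {F : Tensor4 → ℝ} (hFadd : ∀ A B, F (A + B) = F A + F B)
    {β0 : ℕ → ℝ} (hβ : ∀ j, β0 j = F (m2Tensor (T j))) {μ ν : Fin 4}
    {Bset : ℕ → Finset κB} {wt : ℕ → κB → ℝ} {F' G' : κB → ι → ℕ → Pt → ℝ} {M : ℕ → ℕ} {U : ℝ}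
    (hrep : OneShotRepresentation Lc F 𝒯 s cc₀ μ ν Bset wt F' G' M U) :
    ∀ m : ℕ, 1 ≤ m → ∃ R₀ : ℕ, M (Lc ^ m) ≤ R₀ ∧
      |composedCoeff (fun j _ => β0 j) m
        - ∑ b ∈ Bset (Lc ^ m), wt (Lc ^ m) b * ∑ w ∈ annulus 4 0 R₀, toReal w μ * toReal w ν *
          ∑ i ∈ s, cc₀ i * (F' b i (Lc ^ m) w * G' b i (Lc ^ m) w)| ≤ U := by
  intro m hm
  obtain ⟨R₀, hR₀, h⟩ := hrep m hm
  refine ⟨R₀, hR₀, ?_⟩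
  rw [composedCoeff_trivial, flowSum_eq_oneShotReadout hTA hT0 hT1 htel hFadd hβ hm]
  exact h

/-- … with (T0)/(T1) from the two symmetries. [folklore] -/
theorem hident_trivial_of_scalewise_of_symmetries {Lc : ℕ} [NeZero Lc] {T 𝒯 : ℕ → EKer 4}
    (hTA : ∀ j c e, AbsMoment₂ (T j c e))
    (hdiv : ∀ j (ν : Fin 4) (x : Fin 4 → ℤ), ∑ μ, (T j μ ν x - T j μ ν (x - Pi.single μ 1)) = 0)
    (hinv : ∀ j (μ ν : Fin 4) (y : Fin 4 → ℤ), T j μ ν ((Pi.single ν 1 - Pi.single μ 1) - y) = T j μ ν y)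
    (htel : HessianTelescoping Lc T 𝒯) {F : Tensor4 → ℝ} (hFadd : ∀ A B, F (A + B) = F A + F B)
    {β0 : ℕ → ℝ} (hβ : ∀ j, β0 j = F (m2Tensor (T j))) {μ ν : Fin 4}
    {Bset : ℕ → Finset κB} {wt : ℕ → κB → ℝ} {F' G' : κB → ι → ℕ → Pt → ℝ} {M : ℕ → ℕ} {U : ℝ}
    (hrep : OneShotRepresentation Lc F 𝒯 s cc₀ μ ν Bset wt F' G' M U) :
    ∀ m : ℕ, 1 ≤ m → ∃ R₀ : ℕ, M (Lc ^ m) ≤ R₀ ∧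
      |composedCoeff (fun j _ => β0 j) m
        - ∑ b ∈ Bset (Lc ^ m), wt (Lc ^ m) b * ∑ w ∈ annulus 4 0 R₀, toReal w μ * toReal w ν *
          ∑ i ∈ s, cc₀ i * (F' b i (Lc ^ m) w * G' b i (Lc ^ m) w)| ≤ U := by
  intro m hm
  obtain ⟨R₀, hR₀, h⟩ := hrep m hm
  refine ⟨R₀, hR₀, ?_⟩
  rw [composedCoeff_trivial, flowSum_eq_oneShotReadout_of_symmetries hTA hdiv hinv htel hFadd hβ hm]
  exact h

/-- **NO FREE LUNCH**: under (N1-B), `hβ`, the Hessian data and additivity, (I2-rep) is EQUIVALENT to (D1) — the split moves content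
only when `T j`, `𝒯 m` are the genuine Hessian kernels (beta-ref A-R290 / C-beta-167). [folklore] -/
theorem oneShotRep_iff_hident_of_telescoping {Lc : ℕ} [NeZero Lc] {T 𝒯 : ℕ → EKer 4}
    (hTA : ∀ j c e, AbsMoment₂ (T j c e)) (hT0 : ∀ j c e, HasSum (T j c e) 0)
    (hT1 : ∀ j c e (ρ : Fin 4), HasSum (fun t : Fin 4 → ℤ => t ρ • T j c e t) 0)
    (htel : HessianTelescoping Lc T 𝒯) {F : Tensor4 → ℝ} (hFadd : ∀ A B, F (A + B) = F A + F B)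
    {β0 : ℕ → ℝ} (hβ : ∀ j, β0 j = F (m2Tensor (T j))) {μ ν : Fin 4}
    {Bset : ℕ → Finset κB} {wt : ℕ → κB → ℝ} {F' G' : κB → ι → ℕ → Pt → ℝ} {M : ℕ → ℕ} {U : ℝ} :
    OneShotRepresentation Lc F 𝒯 s cc₀ μ ν Bset wt F' G' M U ↔
      ∀ m : ℕ, 1 ≤ m → ∃ R₀ : ℕ, M (Lc ^ m) ≤ R₀ ∧
        |composedCoeff (fun j _ => β0 j) m
          - ∑ b ∈ Bset (Lc ^ m), wt (Lc ^ m) b * ∑ w ∈ annulus 4 0 R₀, toReal w μ * toReal w ν *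
            ∑ i ∈ s, cc₀ i * (F' b i (Lc ^ m) w * G' b i (Lc ^ m) w)| ≤ U := by
  refine ⟨fun hrep => hident_trivial_of_scalewise hTA hT0 hT1 htel hFadd hβ hrep, fun h m hm => ?_⟩
  obtain ⟨R₀, hR₀, h'⟩ := h m hm
  refine ⟨R₀, hR₀, ?_⟩
  rw [← flowSum_eq_oneShotReadout hTA hT0 hT1 htel hFadd hβ hm, ← composedCoeff_trivial]
  exact h'

/-- **THE WALL'S DRIFT FROM THE SCALE-WISE FORM** (trivial instance, RULING (R16-1)): `ComposedRoad.oneLoopDrift_of_composedLegInterfacePow_identity_avg`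
with `μC := fun j _ => Sβ.β0 j`, `hid := rfl`, and `hident` = (D1) supplied by `hident_trivial_of_scalewise` from `hβ`, Hessian data,
(N1-B) `HessianTelescoping`, (I2-rep) `OneShotRepresentation` and additivity of `F`.  SAME conclusion and constant as the wall. [folklore] -/
theorem oneLoopDrift_of_scalewise {β : HBeta} (Sβ : B12Beta.OneLoopSplit β)
    (hdeg : ∀ i ∈ s, (P i).a + (Q i).a = 6) {μ ν : Fin 4} (hμν : μ ≠ ν) {N : ℝ} (hN : N ≠ 0)
    (hval : ∀ x : E4, x ≠ 0 → x μ * x ν * contBubble s cc₀ P Q x = leadingIntegrand (kappaBal N) μ ν x)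
    {Lc : ℕ} [NeZero Lc] (hL : 2 ≤ Lc)
    -- the scale-wise one-loop data
    (T 𝒯 : ℕ → EKer 4) (hTA : ∀ j c e, AbsMoment₂ (T j c e)) (hT0 : ∀ j c e, HasSum (T j c e) 0)
    (hT1 : ∀ j c e (ρ : Fin 4), HasSum (fun t : Fin 4 → ℤ => t ρ • T j c e t) 0)
    (F : Tensor4 → ℝ) (hFadd : ∀ A B, F (A + B) = F A + F B) (hβ : ∀ j, Sβ.β0 j = F (m2Tensor (T j)))
    (htel : HessianTelescoping Lc T 𝒯)
    -- the leg-level binders of `ComposedRoad` §10, verbatim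
    {F' G' : κB → ι → ℕ → Pt → ℝ} {R Sg R' S' : ι → ℝ} {δ U cc : ℝ} {M : ℕ → ℕ}
    {Bset : ℕ → Finset κB} {wt : ℕ → κB → ℝ}
    (hwt0 : ∀ n : ℕ, 2 ≤ n → ∀ b ∈ Bset n, 0 ≤ wt n b) (hwt1 : ∀ n : ℕ, 2 ≤ n → ∑ b ∈ Bset n, wt n b = 1)
    (hR : ∀ i ∈ s, 0 ≤ R i) (hS : ∀ i ∈ s, 0 ≤ Sg i) (hR' : ∀ i ∈ s, 0 ≤ R' i) (hS' : ∀ i ∈ s, 0 ≤ S' i) (hδ : 0 < δ)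
    (hc : 1 ≤ cc) (hM : ∀ L : ℕ, 2 ≤ L → 1 ≤ M L ∧ (L : ℝ) ≤ cc * M L) (hML : ∀ L : ℕ, 2 ≤ L → M L ≤ L)
    (hF : ∀ m : ℕ, 1 ≤ m → ∀ b ∈ Bset (Lc ^ m), ∀ w' ∈ annulus 4 0 (M (Lc ^ m)), ∀ i ∈ s,
      |F' b i (Lc ^ m) w' - (P i).f (Lc ^ m) 0 w'| ≤ R i / ((supNorm w' : ℝ) ^ ((P i).a - 2) * ((Lc ^ m : ℕ) : ℝ) ^ 2))
    (hG : ∀ m : ℕ, 1 ≤ m → ∀ b ∈ Bset (Lc ^ m), ∀ w' ∈ annulus 4 0 (M (Lc ^ m)), ∀ i ∈ s,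
      |G' b i (Lc ^ m) w' - (Q i).f (Lc ^ m) 0 w'| ≤ Sg i / ((supNorm w' : ℝ) ^ ((Q i).a - 2) * ((Lc ^ m : ℕ) : ℝ) ^ 2))
    (hFtail : ∀ m : ℕ, 1 ≤ m → ∀ b ∈ Bset (Lc ^ m), ∀ r : ℕ, M (Lc ^ m) ≤ r → ∀ w' ∈ annulus 4 r (r + 1), ∀ i ∈ s,
      |F' b i (Lc ^ m) w'| ≤ R' i / ((r : ℝ) + 1) ^ (P i).a * Real.exp (-(δ / ((Lc ^ m : ℕ) : ℝ)) * ((r : ℝ) + 1)))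
    (hGtail : ∀ m : ℕ, 1 ≤ m → ∀ b ∈ Bset (Lc ^ m), ∀ r : ℕ, M (Lc ^ m) ≤ r → ∀ w' ∈ annulus 4 r (r + 1), ∀ i ∈ s,
      |G' b i (Lc ^ m) w'| ≤ S' i / ((r : ℝ) + 1) ^ (Q i).a)
    -- (I2-rep): ONE comparison per scale
    (hrep : OneShotRepresentation Lc F 𝒯 s cc₀ μ ν Bset wt F' G' M U) :
    OneLoopDrift (B12Normalization.stepBal N Lc)
      (constA (|kappaBal N| * 24 + |kappaBal N| * 110592) (bubbleConst s cc₀ P Q)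
          ((80 * (∑ i ∈ s, |cc₀ i| * (R' i * S' i)) * (1 + cc / δ) + U) +
            80 * ∑ i ∈ s, |cc₀ i| * ((((P i).A + (P i).B) * Sg i + R i * ((Q i).A + (Q i).B) + R i * Sg i)))
          cc (kappaBal N * transverseValue)) Sβ.β0 :=
  oneLoopDrift_of_composedLegInterfacePow_identity_avg Sβ hdeg hμν hN hval hL hwt0 hwt1 hR hS hR' hS' hδ hc hM hML hF hG
    hFtail hGtail (hident_trivial_of_scalewise hTA hT0 hT1 htel hFadd hβ hrep) (identityForm_trivial Sβ.β0)

/-- **THE WALL (END STATEMENT) FROM THE SCALE-WISE FORM** (trivial instance): `EndpointExistence Cn` from the §10 averaged leg binders,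
the scale-wise one-loop data (`T`, `𝒯`, Hessian data, additive read-out `F`, `hβ`, (N1-B) `HessianTelescoping`, (I2-rep)
`OneShotRepresentation`) and the downstream binders verbatim.  Subject to the READING CLAUSE of the header. [folklore] -/
theorem endpointExistence_of_scalewise_remainderConst {β : HBeta} {Cn : B12.Construction}
    (hgen : ForwardGenerated Cn β) (Sβ : B12Beta.OneLoopSplit β)
    (hdeg : ∀ i ∈ s, (P i).a + (Q i).a = 6) {μ ν : Fin 4} (hμν : μ ≠ ν) {N : ℝ} (hN : N ≠ 0)
    (hval : ∀ x : E4, x ≠ 0 → x μ * x ν * contBubble s cc₀ P Q x = leadingIntegrand (kappaBal N) μ ν x)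
    {Lc : ℕ} [NeZero Lc] (hL : 2 ≤ Lc)
    (T 𝒯 : ℕ → EKer 4) (hTA : ∀ j c e, AbsMoment₂ (T j c e)) (hT0 : ∀ j c e, HasSum (T j c e) 0)
    (hT1 : ∀ j c e (ρ : Fin 4), HasSum (fun t : Fin 4 → ℤ => t ρ • T j c e t) 0)
    (F : Tensor4 → ℝ) (hFadd : ∀ A B, F (A + B) = F A + F B) (hβ : ∀ j, Sβ.β0 j = F (m2Tensor (T j)))
    (htel : HessianTelescoping Lc T 𝒯)
    {F' G' : κB → ι → ℕ → Pt → ℝ} {R Sg R' S' : ι → ℝ} {δ U cc : ℝ} {M : ℕ → ℕ}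
    {Bset : ℕ → Finset κB} {wt : ℕ → κB → ℝ}
    (hwt0 : ∀ n : ℕ, 2 ≤ n → ∀ b ∈ Bset n, 0 ≤ wt n b) (hwt1 : ∀ n : ℕ, 2 ≤ n → ∑ b ∈ Bset n, wt n b = 1)
    (hR : ∀ i ∈ s, 0 ≤ R i) (hS : ∀ i ∈ s, 0 ≤ Sg i) (hR' : ∀ i ∈ s, 0 ≤ R' i) (hS' : ∀ i ∈ s, 0 ≤ S' i) (hδ : 0 < δ)
    (hc : 1 ≤ cc) (hM : ∀ L : ℕ, 2 ≤ L → 1 ≤ M L ∧ (L : ℝ) ≤ cc * M L) (hML : ∀ L : ℕ, 2 ≤ L → M L ≤ L)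
    (hF : ∀ m : ℕ, 1 ≤ m → ∀ b ∈ Bset (Lc ^ m), ∀ w' ∈ annulus 4 0 (M (Lc ^ m)), ∀ i ∈ s,
      |F' b i (Lc ^ m) w' - (P i).f (Lc ^ m) 0 w'| ≤ R i / ((supNorm w' : ℝ) ^ ((P i).a - 2) * ((Lc ^ m : ℕ) : ℝ) ^ 2))
    (hG : ∀ m : ℕ, 1 ≤ m → ∀ b ∈ Bset (Lc ^ m), ∀ w' ∈ annulus 4 0 (M (Lc ^ m)), ∀ i ∈ s,
      |G' b i (Lc ^ m) w' - (Q i).f (Lc ^ m) 0 w'| ≤ Sg i / ((supNorm w' : ℝ) ^ ((Q i).a - 2) * ((Lc ^ m : ℕ) : ℝ) ^ 2))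
    (hFtail : ∀ m : ℕ, 1 ≤ m → ∀ b ∈ Bset (Lc ^ m), ∀ r : ℕ, M (Lc ^ m) ≤ r → ∀ w' ∈ annulus 4 r (r + 1), ∀ i ∈ s,
      |F' b i (Lc ^ m) w'| ≤ R' i / ((r : ℝ) + 1) ^ (P i).a * Real.exp (-(δ / ((Lc ^ m : ℕ) : ℝ)) * ((r : ℝ) + 1)))
    (hGtail : ∀ m : ℕ, 1 ≤ m → ∀ b ∈ Bset (Lc ^ m), ∀ r : ℕ, M (Lc ^ m) ≤ r → ∀ w' ∈ annulus 4 r (r + 1), ∀ i ∈ s,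
      |G' b i (Lc ^ m) w'| ≤ S' i / ((r : ℝ) + 1) ^ (Q i).a)
    (hrep : OneShotRepresentation Lc F 𝒯 s cc₀ μ ν Bset wt F' G' M U)
    {rr γ₀ β' : ℝ} (hγ₀ : 0 < γ₀) (hrem : RemainderConst Sβ γ₀ rr) (hr : rr ≤ B12Normalization.stepBal N Lc)
    (hβ' : 0 ≤ β') (hcont : BetaContH γ₀ β) (hup : BetaUpperH β' γ₀ β) : EndpointExistence Cn :=
  endpointExistence_of_composedLegInterfacePow_identity_avg_remainderConst hgen Sβ hdeg hμν hN hval hL hwt0 hwt1 hR hS hR' hS'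
    hδ hc hM hML hF hG hFtail hGtail (hident_trivial_of_scalewise hTA hT0 hT1 htel hFadd hβ hrep) (identityForm_trivial Sβ.β0)
    hγ₀ hrem hr hβ' hcont hup

/-- **… with (T0)/(T1) from the two symmetries of the Hessian kernels** (divergence-freeness + midpoint inversion). [folklore] -/
theorem endpointExistence_of_scalewise_remainderConst_of_symmetries {β : HBeta} {Cn : B12.Construction}
    (hgen : ForwardGenerated Cn β) (Sβ : B12Beta.OneLoopSplit β)
    (hdeg : ∀ i ∈ s, (P i).a + (Q i).a = 6) {μ ν : Fin 4} (hμν : μ ≠ ν) {N : ℝ} (hN : N ≠ 0)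
    (hval : ∀ x : E4, x ≠ 0 → x μ * x ν * contBubble s cc₀ P Q x = leadingIntegrand (kappaBal N) μ ν x)
    {Lc : ℕ} [NeZero Lc] (hL : 2 ≤ Lc)
    (T 𝒯 : ℕ → EKer 4) (hTA : ∀ j c e, AbsMoment₂ (T j c e))
    (hdiv : ∀ j (ν' : Fin 4) (x : Fin 4 → ℤ), ∑ μ', (T j μ' ν' x - T j μ' ν' (x - Pi.single μ' 1)) = 0)
    (hinv : ∀ j (μ' ν' : Fin 4) (y : Fin 4 → ℤ), T j μ' ν' ((Pi.single ν' 1 - Pi.single μ' 1) - y) = T j μ' ν' y)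
    (F : Tensor4 → ℝ) (hFadd : ∀ A B, F (A + B) = F A + F B) (hβ : ∀ j, Sβ.β0 j = F (m2Tensor (T j)))
    (htel : HessianTelescoping Lc T 𝒯)
    {F' G' : κB → ι → ℕ → Pt → ℝ} {R Sg R' S' : ι → ℝ} {δ U cc : ℝ} {M : ℕ → ℕ}
    {Bset : ℕ → Finset κB} {wt : ℕ → κB → ℝ}
    (hwt0 : ∀ n : ℕ, 2 ≤ n → ∀ b ∈ Bset n, 0 ≤ wt n b) (hwt1 : ∀ n : ℕ, 2 ≤ n → ∑ b ∈ Bset n, wt n b = 1)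
    (hR : ∀ i ∈ s, 0 ≤ R i) (hS : ∀ i ∈ s, 0 ≤ Sg i) (hR' : ∀ i ∈ s, 0 ≤ R' i) (hS' : ∀ i ∈ s, 0 ≤ S' i) (hδ : 0 < δ)
    (hc : 1 ≤ cc) (hM : ∀ L : ℕ, 2 ≤ L → 1 ≤ M L ∧ (L : ℝ) ≤ cc * M L) (hML : ∀ L : ℕ, 2 ≤ L → M L ≤ L)
    (hF : ∀ m : ℕ, 1 ≤ m → ∀ b ∈ Bset (Lc ^ m), ∀ w' ∈ annulus 4 0 (M (Lc ^ m)), ∀ i ∈ s,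
      |F' b i (Lc ^ m) w' - (P i).f (Lc ^ m) 0 w'| ≤ R i / ((supNorm w' : ℝ) ^ ((P i).a - 2) * ((Lc ^ m : ℕ) : ℝ) ^ 2))
    (hG : ∀ m : ℕ, 1 ≤ m → ∀ b ∈ Bset (Lc ^ m), ∀ w' ∈ annulus 4 0 (M (Lc ^ m)), ∀ i ∈ s,
      |G' b i (Lc ^ m) w' - (Q i).f (Lc ^ m) 0 w'| ≤ Sg i / ((supNorm w' : ℝ) ^ ((Q i).a - 2) * ((Lc ^ m : ℕ) : ℝ) ^ 2))
    (hFtail : ∀ m : ℕ, 1 ≤ m → ∀ b ∈ Bset (Lc ^ m), ∀ r : ℕ, M (Lc ^ m) ≤ r → ∀ w' ∈ annulus 4 r (r + 1), ∀ i ∈ s,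
      |F' b i (Lc ^ m) w'| ≤ R' i / ((r : ℝ) + 1) ^ (P i).a * Real.exp (-(δ / ((Lc ^ m : ℕ) : ℝ)) * ((r : ℝ) + 1)))
    (hGtail : ∀ m : ℕ, 1 ≤ m → ∀ b ∈ Bset (Lc ^ m), ∀ r : ℕ, M (Lc ^ m) ≤ r → ∀ w' ∈ annulus 4 r (r + 1), ∀ i ∈ s,
      |G' b i (Lc ^ m) w'| ≤ S' i / ((r : ℝ) + 1) ^ (Q i).a)
    (hrep : OneShotRepresentation Lc F 𝒯 s cc₀ μ ν Bset wt F' G' M U)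
    {rr γ₀ β' : ℝ} (hγ₀ : 0 < γ₀) (hrem : RemainderConst Sβ γ₀ rr) (hr : rr ≤ B12Normalization.stepBal N Lc)
    (hβ' : 0 ≤ β') (hcont : BetaContH γ₀ β) (hup : BetaUpperH β' γ₀ β) : EndpointExistence Cn :=
  endpointExistence_of_composedLegInterfacePow_identity_avg_remainderConst hgen Sβ hdeg hμν hN hval hL hwt0 hwt1 hR hS hR' hS'
    hδ hc hM hML hF hG hFtail hGtail
    (hident_trivial_of_scalewise_of_symmetries hTA hdiv hinv htel hFadd hβ hrep) (identityForm_trivial Sβ.β0)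
    hγ₀ hrem hr hβ' hcont hup

/-! ## §4 Kernel-level telescoping implies tensor-level telescoping -/

/-- The summand of `coarseTensor` for the solution-operator kernel is summable (from an2's `bondSecondMoment_minimiser`). [folklore] -/
theorem summable_coarseSummand {N : ℕ} [NeZero N] (T : EKer 4) (hTA : ∀ c e, AbsMoment₂ (T c e))
    (hT0 : ∀ c e, HasSum (T c e) 0) (hT1 : ∀ c e (ρ : Fin 4), HasSum (fun t : Fin 4 → ℤ => t ρ • T c e t) 0)
    (κ lam a b : Fin 4) :
    Summable (fun z : Fin 4 → ℤ =>
      ((z κ * z lam : ℤ) : ℝ) * ((N : ℝ) ^ 8 * dressedEntry (wK N) T ((N : ℤ) • z) a b)) := by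
  have h := (bondSecondMoment_minimiser (N := N) T hTA hT0 hT1 κ lam a b).summable
  refine h.congr (fun z => ?_)
  norm_num

/-- **KERNEL TELESCOPING ⟹ HESSIAN TELESCOPING**, given the Hessian data (so that every second-moment sum converges). [folklore] -/
theorem hessianTelescoping_of_kernelTelescoping {Lc : ℕ} [NeZero Lc] {T 𝒯 : ℕ → EKer 4}
    (hTA : ∀ j c e, AbsMoment₂ (T j c e)) (hT0 : ∀ j c e, HasSum (T j c e) 0)
    (hT1 : ∀ j c e (ρ : Fin 4), HasSum (fun t : Fin 4 → ℤ => t ρ • T j c e t) 0)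
    (hker : KernelTelescoping Lc T 𝒯) : HessianTelescoping Lc T 𝒯 := by
  intro m hm
  funext κ lam a b
  have hs : ∀ j ∈ range m, Summable (fun z : Fin 4 → ℤ =>
      ((z κ * z lam : ℤ) : ℝ) * ((((Lc ^ (m - j) : ℕ) : ℝ)) ^ 8 *
        dressedEntry (wK (Lc ^ (m - j))) (T j) ((((Lc ^ (m - j) : ℕ) : ℤ)) • z) a b)) :=
    fun j _ => summable_coarseSummand (N := Lc ^ (m - j)) (T j) (hTA j) (hT0 j) (hT1 j) κ lam a b
  rw [Finset.sum_apply, Finset.sum_apply, Finset.sum_apply, Finset.sum_apply]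
  simp only [coarseTensor, m2Tensor]
  rw [← Summable.tsum_finsetSum hs]
  refine tsum_congr (fun z => ?_)
  rw [← hker m hm a b z, zsmul_eq_mul, Finset.mul_sum]

end Literature.MathematicalPhysics.QuantumFieldTheory.Balaban1983to89.Beta.HidentScalewise

end
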